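import Literature.Analysis.FluidPDE.CKNTenThirdsInterpolation
import Literature.Analysis.FluidPDE.CylinderAubinLions
import HarnessLib

/-!
# Uniform `L^{10/3}` bounds on compact subsets of a cylinder and strong `L³` convergence

Analysis/FluidPDE theorem file (no definitions, no named facts), part of the discharge of
`Literature.Analysis.FluidPDE.bradshawTsai2019_cylinderCompactness` (Bradshaw–Tsai 2019, §4.3:
"`vₖ` are uniformly bounded in `L^∞(0,T;L²(B₁)) ∩ L²(0,T;H¹(B₁))` (hence also in
`L^{10/3}(0,T;L^{10/3}(B₁))`) … Since they are uniformly bounded in `L^{10/3}`, they also converge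
in `L^q(0,T;L^q(B₁))` for any `q < 10/3`"). We prove the interior version used for the passage to
the limit in the local energy inequality: for fields `Vₙ` on `W = (a, b) × B_R(x₀)` with
`∫_B |Vₙ(t)|² ≤ C` for a.e. `t` and weak spatial gradients with `∬_W |∇Vₙ|² ≤ C`, every compact
`K ⊆ W` carries a uniform bound `∬_K |Vₙ|^{10/3} ≤ M_K < ∞` (cover `K` by finitely many backward
parabolic cylinders inside `W` and apply the tree's scale-invariant multiplicative inequality
`exists_lintegral_tenThirds_backward_le`, Lemarié-Rieusset 2016, (13.18)); consequently, if
`Vₙ → u` in `L²(W)` then `u ∈ L^{10/3}(K)` (Fatou along an a.e. convergent subsequence) and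
`Vₙ → u` in `L³(K)` (Hölder interpolation between `L²` and `L^{10/3}`).

## References

* Z. Bradshaw, T.-P. Tsai, Analysis & PDE 12 (2019), §4.3. [BradshawTsai2019]
* P. G. Lemarié-Rieusset, *The Navier–Stokes problem in the 21st century* (2016), §13.9,
  (13.17)–(13.18). [LemarieRieusset2016]
-/

noncomputable section

open MeasureTheory Set Function Filter Topology TopologicalSpace Metric
open scoped NNReal ENNReal InnerProductSpace RealInnerProductSpace

namespace Literature.Analysis.FluidPDE

/-! ### Interpolation `L³ ⊂ [L², L^{10/3}]` -/

section Interp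

variable {α : Type*} [MeasurableSpace α]

/-- Lebesgue interpolation `∫ f³ ≤ (∫ f²)^{1/4} (∫ f^{10/3})^{3/4}` (Hölder with exponents `4` and
`4/3` applied to `f^{1/2} · f^{5/2}`). [folklore] -/
theorem lintegral_rpow_three_le_interpolation (μ : Measure α) {f : α → ℝ≥0∞} (hf : AEMeasurable f μ) :
    ∫⁻ x, f x ^ (3 : ℝ) ∂μ ≤
      (∫⁻ x, f x ^ (2 : ℝ) ∂μ) ^ (1 / 4 : ℝ) * (∫⁻ x, f x ^ (10 / 3 : ℝ) ∂μ) ^ (3 / 4 : ℝ) := by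
  have hpq : (4 : ℝ).HolderConjugate (4 / 3) := Real.holderConjugate_iff.2 ⟨by norm_num, by norm_num⟩
  have key := ENNReal.lintegral_mul_le_Lp_mul_Lq μ hpq (hf.pow_const (1 / 2 : ℝ))
    (hf.pow_const (5 / 2 : ℝ))
  have h1 : ∀ x, f x ^ (1 / 2 : ℝ) * f x ^ (5 / 2 : ℝ) = f x ^ (3 : ℝ) := fun x => by
    rw [← ENNReal.rpow_add_of_nonneg _ _ (by norm_num) (by norm_num)]
    norm_num
  have h2 : ∀ x, (f x ^ (1 / 2 : ℝ)) ^ (4 : ℝ) = f x ^ (2 : ℝ) := fun x => by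
    rw [← ENNReal.rpow_mul]
    norm_num
  have h3 : ∀ x, (f x ^ (5 / 2 : ℝ)) ^ (4 / 3 : ℝ) = f x ^ (10 / 3 : ℝ) := fun x => by
    rw [← ENNReal.rpow_mul]
    norm_num
  simp only [Pi.mul_apply, h1, h2, h3] at key
  rw [show (1 : ℝ) / (4 / 3) = 3 / 4 by norm_num] at key
  exact key

/-- An `L^{10/3}` bound on a set of finite measure gives an `L³` bound:
`∫_S f³ ≤ |S|^{1/10} (∫_S f^{10/3})^{9/10}`. [folklore] -/
theorem lintegral_rpow_three_le_of_tenThirds (μ : Measure α) {f : α → ℝ≥0∞} (hf : AEMeasurable f μ) :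
    ∫⁻ x, f x ^ (3 : ℝ) ∂μ ≤ μ univ ^ (1 / 10 : ℝ) * (∫⁻ x, f x ^ (10 / 3 : ℝ) ∂μ) ^ (9 / 10 : ℝ) := by
  have hpq : (10 : ℝ).HolderConjugate (10 / 9) := Real.holderConjugate_iff.2 ⟨by norm_num, by norm_num⟩
  have key := ENNReal.lintegral_mul_le_Lp_mul_Lq μ hpq (f := fun _ => (1 : ℝ≥0∞)) aemeasurable_const
    (hf.pow_const (3 : ℝ))
  have h3 : ∀ x, (f x ^ (3 : ℝ)) ^ (10 / 9 : ℝ) = f x ^ (10 / 3 : ℝ) := fun x => by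
    rw [← ENNReal.rpow_mul]
    norm_num
  simp only [Pi.mul_apply, one_mul, ENNReal.one_rpow, lintegral_const, h3] at key
  rw [show (1 : ℝ) / (10 / 9) = 9 / 10 by norm_num] at key
  exact key

end Interp

/-! ### Finite unions -/

section Union

variable {α : Type*} [MeasurableSpace α] {μ : Measure α}

/-- Subadditivity of the lower integral over a finite union of sets. [folklore] -/
theorem lintegral_biUnion_finset_le_sum {ι : Type*} (t : Finset ι) (U : ι → Set α) (f : α → ℝ≥0∞) :
    ∫⁻ a in ⋃ i ∈ t, U i, f a ∂μ ≤ ∑ i ∈ t, ∫⁻ a in U i, f a ∂μ := by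
  classical
  induction t using Finset.induction_on with
  | empty => simp
  | insert i t hi ih =>
    rw [Finset.set_biUnion_insert, Finset.sum_insert hi]
    exact (lintegral_union_le _ _ _).trans (add_le_add le_rfl ih)

end Union

/-! ### The `L^{10/3}` bound on parabolic cylinders inside the cylinder `W` -/

section Cylinder

variable {x₀ : EuclideanSpace ℝ (Fin 3)} {R a b : ℝ}

/-- **The scale-invariant `L^{10/3}` bound on a backward parabolic cylinder inside `W`.** If `V`
has a weak spatial gradient `G` on `W = (a, b) × B_R(x₀)` with `∫_B |V(t)|² ≤ C` for a.e. `t` and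
`∬_W |G|² ≤ C`, then on every `Q_r(z) ⊆ W`,
`∬_{Q_r(z)} |V|^{10/3} ≤ K r^{5/3} (C/r)^{2/3} (2C/r)` with the absolute `K` of
`exists_lintegral_tenThirds_backward_le` (Lemarié-Rieusset 2016, (13.18)). [cite: LemarieRieusset2016, §13.9 (13.17)–(13.18)] -/
theorem setLIntegral_tenThirds_parabolicCylinder_le {K : ℝ≥0}
    (hK : ∀ (u : ℝ → EuclideanSpace ℝ (Fin 3) → EuclideanSpace ℝ (Fin 3))
      (G : ℝ → EuclideanSpace ℝ (Fin 3) → EuclideanSpace ℝ (Fin 3) →L[ℝ] EuclideanSpace ℝ (Fin 3))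
      (z : ℝ × EuclideanSpace ℝ (Fin 3)) (r : ℝ), 0 < r →
      HasWeakSpatialGradientOn (parabolicCylinderOpens r z) u G →
      cknAEss r z u ≠ ∞ → cknE r z G ≠ ∞ →
      ∫⁻ q in parabolicCylinder r z, ‖u q.1 q.2‖ₑ ^ (10 / 3 : ℝ) ≤
        K * ENNReal.ofReal (r ^ (5 / 3 : ℝ)) * cknAEss r z u ^ (2 / 3 : ℝ) *
          (cknAEss r z u + cknE r z G))
    {C : ℝ≥0} {V : ℝ → EuclideanSpace ℝ (Fin 3) → EuclideanSpace ℝ (Fin 3)}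
    {G : ℝ → EuclideanSpace ℝ (Fin 3) → EuclideanSpace ℝ (Fin 3) →L[ℝ] EuclideanSpace ℝ (Fin 3)}
    (hV : HasWeakSpatialGradientOn (timeCylinder
      (⟨ball x₀ R, isOpen_ball⟩ : Opens (EuclideanSpace ℝ (Fin 3))) a b) V G)
    (hE : ∀ᵐ t ∂((volume : Measure ℝ).restrict (Ioo a b)), ∫⁻ x in ball x₀ R, ‖V t x‖ₑ ^ 2 ≤ C)
    (hGb : ∫⁻ z in Ioo a b ×ˢ ball x₀ R, ENNReal.ofReal (frobeniusNormSq (G z.1 z.2)) ≤ C)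
    {r : ℝ} (hr : 0 < r) {z : ℝ × EuclideanSpace ℝ (Fin 3)}
    (hsub : parabolicCylinder r z ⊆ Ioo a b ×ˢ ball x₀ R) :
    ∫⁻ q in parabolicCylinder r z, ‖V q.1 q.2‖ₑ ^ (10 / 3 : ℝ) ≤
      K * ENNReal.ofReal (r ^ (5 / 3 : ℝ)) * ((ENNReal.ofReal r)⁻¹ * C) ^ (2 / 3 : ℝ) *
        ((ENNReal.ofReal r)⁻¹ * C + (ENNReal.ofReal r)⁻¹ * C) := by
  -- the two inclusions of the factors
  have hsub' : Ioo (z.1 - r ^ 2) z.1 ⊆ Ioo a b ∧ ball z.2 r ⊆ ball x₀ R := by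
    rcases prod_subset_prod_iff.1 hsub with h | h | h
    · exact h
    · exact absurd h (nonempty_Ioo.2 (by nlinarith)).ne_empty
    · exact absurd h (nonempty_ball.2 hr).ne_empty
  have hrinv : (ENNReal.ofReal r)⁻¹ ≠ ∞ := ENNReal.inv_ne_top.2 (ENNReal.ofReal_pos.2 hr).ne'
  -- the scaled energy
  have hA : cknAEss r z V ≤ (ENNReal.ofReal r)⁻¹ * C := by
    refine essSup_le_of_ae_le _ ?_
    have h := ae_restrict_of_ae_restrict_of_subset hsub'.1 hE
    filter_upwards [h] with t ht
    gcongr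
    exact (lintegral_mono_set hsub'.2).trans ht
  -- the scaled dissipation
  have hEq : cknE r z G ≤ (ENNReal.ofReal r)⁻¹ * C := by
    unfold cknE
    gcongr
    exact (lintegral_mono_set hsub).trans hGb
  have hAt : cknAEss r z V ≠ ∞ := ne_top_of_le_ne_top (ENNReal.mul_ne_top hrinv ENNReal.coe_ne_top) hA
  have hEt : cknE r z G ≠ ∞ := ne_top_of_le_ne_top (ENNReal.mul_ne_top hrinv ENNReal.coe_ne_top) hEq
  have hle : parabolicCylinderOpens r z ≤
      timeCylinder (⟨ball x₀ R, isOpen_ball⟩ : Opens (EuclideanSpace ℝ (Fin 3))) a b :=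
    fun w hw => hsub hw
  calc ∫⁻ q in parabolicCylinder r z, ‖V q.1 q.2‖ₑ ^ (10 / 3 : ℝ)
      ≤ K * ENNReal.ofReal (r ^ (5 / 3 : ℝ)) * cknAEss r z V ^ (2 / 3 : ℝ) *
          (cknAEss r z V + cknE r z G) := hK V G z r hr (hV.mono hle) hAt hEt
    _ ≤ K * ENNReal.ofReal (r ^ (5 / 3 : ℝ)) * ((ENNReal.ofReal r)⁻¹ * C) ^ (2 / 3 : ℝ) *
          ((ENNReal.ofReal r)⁻¹ * C + (ENNReal.ofReal r)⁻¹ * C) := by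
        gcongr

/-- **Uniform `L^{10/3}` bounds on compact subsets of the cylinder** (Bradshaw–Tsai 2019, §4.3:
"uniformly bounded in `L^∞L² ∩ L²H¹` (hence also in `L^{10/3}`)", interior form). For a sequence
`Vₙ` with weak spatial gradients `Gₙ` on `W = (a, b) × B_R(x₀)` and the uniform bounds
`∫_B |Vₙ(t)|² ≤ C` (a.e. `t`), `∬_W |Gₙ|² ≤ C`, every compact `K ⊆ W` admits `M < ∞` with
`∬_K |Vₙ|^{10/3} ≤ M` for all `n` (finite cover of `K` by parabolic cylinders inside `W`). [cite: BradshawTsai2019, §4.3 (proof of Thm 1.2, "hence also in L^{10/3}")] -/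
theorem exists_forall_setLIntegral_tenThirds_le_of_isCompact {C : ℝ≥0}
    {V : ℕ → ℝ → EuclideanSpace ℝ (Fin 3) → EuclideanSpace ℝ (Fin 3)}
    {G : ℕ → ℝ → EuclideanSpace ℝ (Fin 3) → EuclideanSpace ℝ (Fin 3) →L[ℝ] EuclideanSpace ℝ (Fin 3)}
    (hV : ∀ n, HasWeakSpatialGradientOn (timeCylinder
      (⟨ball x₀ R, isOpen_ball⟩ : Opens (EuclideanSpace ℝ (Fin 3))) a b) (V n) (G n))
    (hE : ∀ n, ∀ᵐ t ∂((volume : Measure ℝ).restrict (Ioo a b)),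
      ∫⁻ x in ball x₀ R, ‖V n t x‖ₑ ^ 2 ≤ C)
    (hGb : ∀ n, ∫⁻ z in Ioo a b ×ˢ ball x₀ R, ENNReal.ofReal (frobeniusNormSq (G n z.1 z.2)) ≤ C)
    {K : Set (ℝ × EuclideanSpace ℝ (Fin 3))} (hK : IsCompact K) (hKW : K ⊆ Ioo a b ×ˢ ball x₀ R) :
    ∃ M : ℝ≥0∞, M ≠ ∞ ∧ ∀ n, ∫⁻ z in K, ‖V n z.1 z.2‖ₑ ^ (10 / 3 : ℝ) ≤ M := by
  obtain ⟨K₁₀, hK₁₀⟩ := exists_lintegral_tenThirds_backward_le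
  -- a parabolic cylinder inside `W` around every point of `K`
  have hWo : IsOpen (Ioo a b ×ˢ ball x₀ R) := isOpen_Ioo.prod isOpen_ball
  have hcyl : ∀ w : K, ∃ r : ℝ, 0 < r ∧ r ≤ 1 ∧
      parabolicCylinder r ((w : ℝ × EuclideanSpace ℝ (Fin 3)).1 + r ^ 2 / 2,
        (w : ℝ × EuclideanSpace ℝ (Fin 3)).2) ⊆ Ioo a b ×ˢ ball x₀ R := by
    intro w
    obtain ⟨ε, hε, hεW⟩ := Metric.isOpen_iff.1 hWo w (hKW w.2)
    refine ⟨min (ε / 2) 1, lt_min (by positivity) one_pos, min_le_right _ _, ?_⟩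
    set r := min (ε / 2) 1 with hr
    have hr0 : 0 < r := lt_min (by positivity) one_pos
    have hr1 : r ≤ 1 := min_le_right _ _
    have hrε : r ≤ ε / 2 := min_le_left _ _
    have hr2 : r ^ 2 < ε := by nlinarith
    refine Subset.trans ?_ hεW
    rw [← ball_prod_same]
    refine prod_mono ?_ (ball_subset_ball (by linarith))
    intro t ht
    simp only [mem_Ioo] at ht
    rw [mem_ball, Real.dist_eq, abs_lt]
    constructor <;> nlinarith [ht.1, ht.2]
  choose r hr0 hr1 hrW using hcyl
  set U : K → Set (ℝ × EuclideanSpace ℝ (Fin 3)) := fun w =>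
    parabolicCylinder (r w) ((w : ℝ × EuclideanSpace ℝ (Fin 3)).1 + r w ^ 2 / 2,
      (w : ℝ × EuclideanSpace ℝ (Fin 3)).2) with hU
  have hUo : ∀ w, IsOpen (U w) := fun w => isOpen_parabolicCylinder _ _
  have hcover : K ⊆ ⋃ w, U w := by
    intro y hy
    refine mem_iUnion.2 ⟨⟨y, hy⟩, ?_⟩
    rw [hU, mem_parabolicCylinder]
    have h0 := hr0 ⟨y, hy⟩
    refine ⟨⟨?_, ?_⟩, ?_⟩
    · dsimp only; nlinarith
    · dsimp only; nlinarith
    · simpa using h0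
  obtain ⟨t, ht⟩ := hK.elim_finite_subcover U hUo hcover
  -- the bound on each cylinder
  set Mw : K → ℝ≥0∞ := fun w => K₁₀ * ENNReal.ofReal (r w ^ (5 / 3 : ℝ)) *
    ((ENNReal.ofReal (r w))⁻¹ * C) ^ (2 / 3 : ℝ) *
      ((ENNReal.ofReal (r w))⁻¹ * C + (ENNReal.ofReal (r w))⁻¹ * C) with hMw
  have hMwtop : ∀ w, Mw w ≠ ∞ := by
    intro w
    have hrinv : (ENNReal.ofReal (r w))⁻¹ ≠ ∞ :=
      ENNReal.inv_ne_top.2 (ENNReal.ofReal_pos.2 (hr0 w)).ne'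
    have h1 : (ENNReal.ofReal (r w))⁻¹ * C ≠ ∞ := ENNReal.mul_ne_top hrinv ENNReal.coe_ne_top
    refine ENNReal.mul_ne_top (ENNReal.mul_ne_top (ENNReal.mul_ne_top ENNReal.coe_ne_top
      ENNReal.ofReal_ne_top) (ENNReal.rpow_ne_top_of_nonneg (by norm_num) h1))
      (ENNReal.add_ne_top.2 ⟨h1, h1⟩)
  refine ⟨∑ w ∈ t, Mw w, ENNReal.sum_ne_top.2 fun w _ => hMwtop w, fun n => ?_⟩
  calc ∫⁻ z in K, ‖V n z.1 z.2‖ₑ ^ (10 / 3 : ℝ)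
      ≤ ∫⁻ z in ⋃ w ∈ t, U w, ‖V n z.1 z.2‖ₑ ^ (10 / 3 : ℝ) := lintegral_mono_set ht
    _ ≤ ∑ w ∈ t, ∫⁻ z in U w, ‖V n z.1 z.2‖ₑ ^ (10 / 3 : ℝ) := lintegral_biUnion_finset_le_sum _ _ _
    _ ≤ ∑ w ∈ t, Mw w := Finset.sum_le_sum fun w _ =>
        setLIntegral_tenThirds_parabolicCylinder_le hK₁₀ (hV n) (hE n) (hGb n) (hr0 w) (hrW w)

end Cylinder

/-! ### Limits: Fatou and strong `L³` convergence on compact subsets -/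

section Limits

variable {S K : Set (ℝ × EuclideanSpace ℝ (Fin 3))}
  {V : ℕ → ℝ → EuclideanSpace ℝ (Fin 3) → EuclideanSpace ℝ (Fin 3)}
  {u : ℝ → EuclideanSpace ℝ (Fin 3) → EuclideanSpace ℝ (Fin 3)}

/-- **Strong `L²` convergence in seminorm form**: `‖Vₙ - u‖_{L²(S)} → 0` from `∬_S |Vₙ - u|² → 0`.
[folklore] -/
theorem tendsto_eLpNorm_sub_of_tendsto_lintegral_sub_sq
    (hconv : Tendsto (fun n => ∫⁻ z in S, ‖V n z.1 z.2 - u z.1 z.2‖ₑ ^ 2) atTop (𝓝 0)) :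
    Tendsto (fun n => eLpNorm (uncurry (V n) - uncurry u) 2
      ((volume : Measure (ℝ × EuclideanSpace ℝ (Fin 3))).restrict S)) atTop (𝓝 0) := by
  have e : ∀ n, eLpNorm (uncurry (V n) - uncurry u) 2
      ((volume : Measure (ℝ × EuclideanSpace ℝ (Fin 3))).restrict S) =
      (∫⁻ z in S, ‖V n z.1 z.2 - u z.1 z.2‖ₑ ^ 2) ^ (((2 : ℕ) : ℝ)⁻¹) := fun n => by
    have h : ∫⁻ z in S, ‖V n z.1 z.2 - u z.1 z.2‖ₑ ^ 2 = eLpNorm (uncurry (V n) - uncurry u) 2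
        ((volume : Measure (ℝ × EuclideanSpace ℝ (Fin 3))).restrict S) ^ 2 := by
      rw [MollifiedLimits.eLpNorm_two_pow_two]; rfl
    rw [h, ENNReal.pow_rpow_inv_natCast two_ne_zero]
  simp_rw [e]
  have h0 := ((ENNReal.continuous_rpow_const (y := ((2 : ℕ) : ℝ)⁻¹)).tendsto 0).comp hconv
  rw [ENNReal.zero_rpow_of_pos (by positivity)] at h0
  exact h0

/-- **Fatou along an a.e. convergent subsequence**: if `Vₙ → u` in `L²(S)` and
`∬_K |Vₙ|^p ≤ M` for all `n` (`K ⊆ S`), then `∬_K |u|^p ≤ M`. [folklore] -/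
theorem setLIntegral_rpow_le_of_tendsto_lintegral_sub_sq (hKS : K ⊆ S)
    (hVm : ∀ n, AEStronglyMeasurable (uncurry (V n))
      ((volume : Measure (ℝ × EuclideanSpace ℝ (Fin 3))).restrict S))
    (hum : AEStronglyMeasurable (uncurry u)
      ((volume : Measure (ℝ × EuclideanSpace ℝ (Fin 3))).restrict S))
    (hconv : Tendsto (fun n => ∫⁻ z in S, ‖V n z.1 z.2 - u z.1 z.2‖ₑ ^ 2) atTop (𝓝 0))
    (p : ℝ) {M : ℝ≥0∞} (hbd : ∀ n, ∫⁻ z in K, ‖V n z.1 z.2‖ₑ ^ p ≤ M) :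
    ∫⁻ z in K, ‖u z.1 z.2‖ₑ ^ p ≤ M := by
  have hTIM := tendstoInMeasure_of_tendsto_eLpNorm two_ne_zero hVm hum
    (tendsto_eLpNorm_sub_of_tendsto_lintegral_sub_sq hconv)
  obtain ⟨ns, -, hae⟩ := hTIM.exists_seq_tendsto_ae
  have haeK : ∀ᵐ z ∂((volume : Measure (ℝ × EuclideanSpace ℝ (Fin 3))).restrict K),
      Tendsto (fun i => uncurry (V (ns i)) z) atTop (𝓝 (uncurry u z)) :=
    ae_restrict_of_ae_restrict_of_subset hKS hae
  have hlim : ∀ᵐ z ∂((volume : Measure (ℝ × EuclideanSpace ℝ (Fin 3))).restrict K),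
      ‖u z.1 z.2‖ₑ ^ p = liminf (fun i => ‖V (ns i) z.1 z.2‖ₑ ^ p) atTop := by
    filter_upwards [haeK] with z hz
    have h1 : Tendsto (fun i => ‖V (ns i) z.1 z.2‖ₑ ^ p) atTop (𝓝 (‖u z.1 z.2‖ₑ ^ p)) :=
      ((ENNReal.continuous_rpow_const (y := p)).tendsto _).comp hz.enorm
    exact h1.liminf_eq.symm
  calc ∫⁻ z in K, ‖u z.1 z.2‖ₑ ^ p
      = ∫⁻ z in K, liminf (fun i => ‖V (ns i) z.1 z.2‖ₑ ^ p) atTop := lintegral_congr_ae hlim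
    _ ≤ liminf (fun i => ∫⁻ z in K, ‖V (ns i) z.1 z.2‖ₑ ^ p) atTop :=
        lintegral_liminf_le' fun i =>
          ((hVm (ns i)).mono_measure (Measure.restrict_mono hKS le_rfl)).aemeasurable.enorm.pow_const p
    _ ≤ M := liminf_le_of_frequently_le' (Frequently.of_forall fun i => hbd (ns i))

/-- **Strong `L³` convergence on `K` from strong `L²` convergence and uniform `L^{10/3}(K)` bounds**
(Bradshaw–Tsai 2019, §4.3: "Since they are uniformly bounded in `L^{10/3}`, they also converge in
`L^q` for any `q < 10/3`", here `q = 3`; Hölder interpolation). [cite: BradshawTsai2019, §4.3 (proof of Thm 1.2, convergence in L^q, q < 10/3)] -/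
theorem tendsto_setLIntegral_rpow_three_sub (hKS : K ⊆ S)
    (hVm : ∀ n, AEStronglyMeasurable (uncurry (V n))
      ((volume : Measure (ℝ × EuclideanSpace ℝ (Fin 3))).restrict S))
    (hum : AEStronglyMeasurable (uncurry u)
      ((volume : Measure (ℝ × EuclideanSpace ℝ (Fin 3))).restrict S))
    (hconv : Tendsto (fun n => ∫⁻ z in S, ‖V n z.1 z.2 - u z.1 z.2‖ₑ ^ 2) atTop (𝓝 0))
    {M : ℝ≥0∞} (hM : M ≠ ∞) (hbd : ∀ n, ∫⁻ z in K, ‖V n z.1 z.2‖ₑ ^ (10 / 3 : ℝ) ≤ M)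
    (hbu : ∫⁻ z in K, ‖u z.1 z.2‖ₑ ^ (10 / 3 : ℝ) ≤ M) :
    Tendsto (fun n => ∫⁻ z in K, ‖V n z.1 z.2 - u z.1 z.2‖ₑ ^ (3 : ℝ)) atTop (𝓝 0) := by
  have hm : ∀ n, AEMeasurable (fun z : ℝ × EuclideanSpace ℝ (Fin 3) => ‖V n z.1 z.2 - u z.1 z.2‖ₑ)
      ((volume : Measure (ℝ × EuclideanSpace ℝ (Fin 3))).restrict K) := fun n =>
    (((hVm n).sub hum).mono_measure (Measure.restrict_mono hKS le_rfl)).aemeasurable.enorm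
  have humK : AEMeasurable (fun z : ℝ × EuclideanSpace ℝ (Fin 3) => ‖u z.1 z.2‖ₑ ^ (10 / 3 : ℝ))
      ((volume : Measure (ℝ × EuclideanSpace ℝ (Fin 3))).restrict K) :=
    ((hum.mono_measure (Measure.restrict_mono hKS le_rfl)).aemeasurable.enorm.pow_const _)
  -- the uniform `L^{10/3}` bound of the differences
  set M' : ℝ≥0∞ := 2 ^ ((10 / 3 : ℝ) - 1) * (M + M) with hM'
  have h2top : (2 : ℝ≥0∞) ^ ((10 / 3 : ℝ) - 1) ≠ ∞ :=
    ENNReal.rpow_ne_top_of_nonneg (by norm_num) ENNReal.ofNat_ne_top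
  have hM'top : M' ≠ ∞ := ENNReal.mul_ne_top h2top (ENNReal.add_ne_top.2 ⟨hM, hM⟩)
  have hdiff : ∀ n, ∫⁻ z in K, ‖V n z.1 z.2 - u z.1 z.2‖ₑ ^ (10 / 3 : ℝ) ≤ M' := fun n => by
    calc ∫⁻ z in K, ‖V n z.1 z.2 - u z.1 z.2‖ₑ ^ (10 / 3 : ℝ)
        ≤ ∫⁻ z in K, 2 ^ ((10 / 3 : ℝ) - 1) *
            (‖V n z.1 z.2‖ₑ ^ (10 / 3 : ℝ) + ‖u z.1 z.2‖ₑ ^ (10 / 3 : ℝ)) := by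
          refine lintegral_mono fun z => ?_
          exact (ENNReal.rpow_le_rpow enorm_sub_le (by norm_num)).trans
            (ENNReal.rpow_add_le_mul_rpow_add_rpow _ _ (by norm_num))
      _ = 2 ^ ((10 / 3 : ℝ) - 1) * ((∫⁻ z in K, ‖V n z.1 z.2‖ₑ ^ (10 / 3 : ℝ)) +
            ∫⁻ z in K, ‖u z.1 z.2‖ₑ ^ (10 / 3 : ℝ)) := by
          rw [lintegral_const_mul' _ _ h2top, lintegral_add_right' _ humK]
      _ ≤ M' := by rw [hM']; gcongr; exact hbd n
  -- interpolation and squeeze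
  have hle : ∀ n, ∫⁻ z in K, ‖V n z.1 z.2 - u z.1 z.2‖ₑ ^ (3 : ℝ) ≤
      (∫⁻ z in S, ‖V n z.1 z.2 - u z.1 z.2‖ₑ ^ 2) ^ (1 / 4 : ℝ) * M' ^ (3 / 4 : ℝ) := fun n => by
    calc ∫⁻ z in K, ‖V n z.1 z.2 - u z.1 z.2‖ₑ ^ (3 : ℝ)
        ≤ (∫⁻ z in K, ‖V n z.1 z.2 - u z.1 z.2‖ₑ ^ (2 : ℝ)) ^ (1 / 4 : ℝ) *
            (∫⁻ z in K, ‖V n z.1 z.2 - u z.1 z.2‖ₑ ^ (10 / 3 : ℝ)) ^ (3 / 4 : ℝ) :=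
          lintegral_rpow_three_le_interpolation _ (hm n)
      _ ≤ (∫⁻ z in S, ‖V n z.1 z.2 - u z.1 z.2‖ₑ ^ 2) ^ (1 / 4 : ℝ) * M' ^ (3 / 4 : ℝ) := by
          have hKS' : ∫⁻ z in K, ‖V n z.1 z.2 - u z.1 z.2‖ₑ ^ (2 : ℝ) ≤
              ∫⁻ z in S, ‖V n z.1 z.2 - u z.1 z.2‖ₑ ^ 2 := by
            calc ∫⁻ z in K, ‖V n z.1 z.2 - u z.1 z.2‖ₑ ^ (2 : ℝ)
                = ∫⁻ z in K, ‖V n z.1 z.2 - u z.1 z.2‖ₑ ^ 2 := by simp_rw [ENNReal.rpow_two]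
              _ ≤ ∫⁻ z in S, ‖V n z.1 z.2 - u z.1 z.2‖ₑ ^ 2 := lintegral_mono_set hKS
          exact mul_le_mul' (ENNReal.rpow_le_rpow hKS' (by norm_num))
            (ENNReal.rpow_le_rpow (hdiff n) (by norm_num))
  have hA : Tendsto (fun n => (∫⁻ z in S, ‖V n z.1 z.2 - u z.1 z.2‖ₑ ^ 2) ^ (1 / 4 : ℝ) *
      M' ^ (3 / 4 : ℝ)) atTop (𝓝 0) := by
    have h0 := ((ENNReal.continuous_rpow_const (y := (1 / 4 : ℝ))).tendsto 0).comp hconv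
    rw [ENNReal.zero_rpow_of_pos (by norm_num)] at h0
    have h1 := ENNReal.Tendsto.mul_const h0 (b := M' ^ (3 / 4 : ℝ))
      (Or.inr (ENNReal.rpow_ne_top_of_nonneg (by norm_num) hM'top))
    simpa using h1
  exact tendsto_of_tendsto_of_tendsto_of_le_of_le tendsto_const_nhds hA (fun n => bot_le) hle

end Limits

end Literature.Analysis.FluidPDE

end
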